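import Mathlib
import HarnessLib
import Literature.NumberTheory.DiophantineGeometry.SquarefulSums

/-!
# The summand of the Browning–Van Valckenborgh constant: solubility conditions and closed form

For `y = (a, b, c)` with `μ²(abc) = 1`, the term `bvvSummand y` of the series (2.4) of
Browning–Van Valckenborgh 2012 is non-zero exactly when the local conditions hold, and then it
has the closed form `(abc)^{-1/2} ∏_{odd p ∣ abc} 2/(p+1)`:

* `bvvSummand_ne_zero_conditions` — `bvvSummand y ≠ 0` gives Legendre's conditions
  (`(bc/p) = 1` for odd `p ∣ a`, `(ac/p) = 1` for odd `p ∣ b`, `(−ab/p) = 1` for odd `p ∣ c`) and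
  the `2`-adic conditions of Lemma 2 (`2 ∣ a ⟹ 8 ∣ b − c`, `2 ∣ b ⟹ 8 ∣ a − c`,
  `2 ∣ c ⟹ 8 ∣ a + b`);
* `bvvSummand_eq_closed` — under `bvvSummand y ≠ 0`,
  `bvvSummand y = (abc)^{-1/2} ∏_{p ∣ abc, p ≠ 2} 2/(p+1)` (since then every odd Euler factor is
  `2p/(p+1)` and `σ₂ · ∏_{odd p ∣ abc} p = abc`).

Everything is proved. [cite: BrowningValckenborgh2012, §2.4 (2.4), Lemmas 1–2]
-/

noncomputable section

open Finset

namespace Literature.NumberTheory.DiophantineGeometry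

/-- At an odd prime `p ∤ n`, `1 + (n/p) ≠ 0` forces `(n/p) = 1`. [folklore] -/
theorem jacobiSym_eq_one_of_one_add_ne_zero {n : ℤ} {p : ℕ} (hp : p.Prime) (hpn : ¬(p : ℤ) ∣ n)
    (h : (1 : ℝ) + (jacobiSym n p : ℝ) ≠ 0) : jacobiSym n p = 1 := by
  haveI : Fact p.Prime := ⟨hp⟩
  rw [← jacobiSym.legendreSym.to_jacobiSym] at h ⊢
  have h0 : (n : ZMod p) ≠ 0 := fun h0 => hpn ((ZMod.intCast_zmod_eq_zero_iff_dvd n p).1 h0)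
  rcases legendreSym.eq_one_or_neg_one p h0 with h1 | h1
  · exact h1
  · exfalso; apply h; rw [h1]; push_cast; ring

/-- An odd Euler factor of (2.4) with all symbols `+1` equals `∏ 2p/(p+1)`. [folklore] -/
theorem bvvOddFactor_eq_of_ne_zero {m : ℤ} {n : ℕ} (hcop : ∀ p ∈ n.primeFactors, ¬(p : ℤ) ∣ m)
    (h : bvvOddFactor m n ≠ 0) :
    (∀ p ∈ n.primeFactors.erase 2, jacobiSym m p = 1) ∧
      bvvOddFactor m n = ∏ p ∈ n.primeFactors.erase 2, (2 * (p : ℝ) / (p + 1)) := by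
  have hfac : ∀ p ∈ n.primeFactors.erase 2, (1 : ℝ) + (jacobiSym m p : ℝ) ≠ 0 := by
    intro p hp h0
    apply h
    unfold bvvOddFactor
    exact Finset.prod_eq_zero hp (by rw [h0, zero_div])
  have hone : ∀ p ∈ n.primeFactors.erase 2, jacobiSym m p = 1 := fun p hp =>
    jacobiSym_eq_one_of_one_add_ne_zero (Nat.prime_of_mem_primeFactors (Finset.mem_erase.1 hp).2)
      (hcop p (Finset.mem_erase.1 hp).2) (hfac p hp)
  refine ⟨hone, ?_⟩
  unfold bvvOddFactor
  refine Finset.prod_congr rfl fun p hp => ?_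
  have hp2 : (0 : ℝ) < p := by exact_mod_cast (Nat.prime_of_mem_primeFactors (Finset.mem_erase.1 hp).2).pos
  rw [hone p hp]
  push_cast
  field_simp
  ring

/-- **The conditions encoded by `bvvSummand y ≠ 0`.** [cite: BrowningValckenborgh2012, §2.4, Lemmas 1–2] -/
theorem bvvSummand_ne_zero_conditions {y : ℕ × ℕ × ℕ} (h : bvvSummand y ≠ 0) :
    Squarefree (y.1 * y.2.1 * y.2.2) ∧ bvvSigmaTwo y.1 y.2.1 y.2.2 ≠ 0 ∧
      (∀ p ∈ y.1.primeFactors.erase 2, jacobiSym ((y.2.1 : ℤ) * y.2.2) p = 1) ∧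
      (∀ p ∈ y.2.1.primeFactors.erase 2, jacobiSym ((y.1 : ℤ) * y.2.2) p = 1) ∧
      (∀ p ∈ y.2.2.primeFactors.erase 2, jacobiSym (-((y.1 : ℤ) * y.2.1)) p = 1) ∧
      (2 ∣ y.1 → (8 : ℤ) ∣ (y.2.1 : ℤ) - y.2.2) ∧ (2 ∣ y.2.1 → (8 : ℤ) ∣ (y.1 : ℤ) - y.2.2) ∧
      (2 ∣ y.2.2 → (8 : ℤ) ∣ (y.1 : ℤ) + y.2.1) := by
  obtain ⟨a, b, c⟩ := y
  simp only at h ⊢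
  by_cases hsq : Squarefree (a * b * c)
  swap
  · exact absurd (by simp [bvvSummand, hsq]) h
  have hS : bvvSummand (a, b, c) = ((a * b * c : ℕ) : ℝ) ^ (-(3 / 2 : ℝ)) * (bvvSigmaTwo a b c : ℝ) *
      (bvvOddFactor ((b : ℤ) * c) a * bvvOddFactor ((a : ℤ) * c) b * bvvOddFactor (-((a : ℤ) * b)) c) := by
    simp [bvvSummand, hsq]
  rw [hS] at h
  have hσ : bvvSigmaTwo a b c ≠ 0 := fun h0 => h (by rw [h0]; simp)
  have hFa : bvvOddFactor ((b : ℤ) * c) a ≠ 0 := fun h0 => h (by rw [h0]; simp)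
  have hFb : bvvOddFactor ((a : ℤ) * c) b ≠ 0 := fun h0 => h (by rw [h0]; simp)
  have hFc : bvvOddFactor (-((a : ℤ) * b)) c ≠ 0 := fun h0 => h (by rw [h0]; simp)
  have habc : a * b * c ≠ 0 := hsq.ne_zero
  have ha : a ≠ 0 := by rintro rfl; simp at habc
  have hb : b ≠ 0 := by rintro rfl; simp at habc
  have hc : c ≠ 0 := by rintro rfl; simp at habc
  -- coprimality: a prime factor of one does not divide the others
  have hsq2 : ∀ x z : ℕ, Squarefree (x * z) → ∀ p, p.Prime → p ∣ x → ¬p ∣ z := by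
    intro x z hxz p hp hx hz
    have : p * p ∣ x * z := mul_dvd_mul hx hz
    exact hp.ne_one (by simpa using hxz p this)
  have hab : Squarefree (a * b) := Squarefree.of_mul_left hsq
  have hac : Squarefree (a * c) := hsq.squarefree_of_dvd ⟨b, by ring⟩
  have hbc : Squarefree (b * c) := Squarefree.of_mul_right (by rwa [mul_assoc] at hsq)
  have hca : Squarefree (c * a) := by rwa [mul_comm] at hac
  have hcb : Squarefree (c * b) := by rwa [mul_comm] at hbc
  have hba : Squarefree (b * a) := by rwa [mul_comm] at hab
  have ndvd : ∀ {x z w : ℕ}, Squarefree (x * z) → Squarefree (x * w) →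
      ∀ p ∈ x.primeFactors, ¬(p : ℤ) ∣ (z : ℤ) * w := by
    intro x z w hxz hxw p hp hdvd
    have hpp := Nat.prime_of_mem_primeFactors hp
    have hpx := Nat.dvd_of_mem_primeFactors hp
    rcases (Nat.prime_iff_prime_int.1 hpp).dvd_or_dvd hdvd with h1 | h1
    · exact hsq2 x z hxz p hpp hpx (Int.natCast_dvd_natCast.1 h1)
    · exact hsq2 x w hxw p hpp hpx (Int.natCast_dvd_natCast.1 h1)
  obtain ⟨qa, -⟩ := bvvOddFactor_eq_of_ne_zero (ndvd hab hac) hFa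
  obtain ⟨qb, -⟩ := bvvOddFactor_eq_of_ne_zero (ndvd hba hbc) hFb
  obtain ⟨qc, -⟩ := bvvOddFactor_eq_of_ne_zero (fun p hp hd => ndvd hca hcb p hp (by
    rwa [dvd_neg] at hd)) hFc
  refine ⟨hsq, hσ, qa, qb, qc, ?_, ?_, ?_⟩
  · intro h2a
    have h2 : Even a := even_iff_two_dvd.2 h2a
    have hodd : ¬Odd (a * b * c) := by
      rw [Nat.not_odd_iff_even]; exact (h2.mul_right b).mul_right c
    unfold bvvSigmaTwo at hσ
    rw [if_neg hodd, if_pos h2] at hσ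
    by_cases hmod : (b : ℤ) ≡ (c : ℤ) [ZMOD 8]
    · exact dvd_sub_comm.1 hmod.dvd
    · exact absurd (if_neg hmod) hσ
  · intro h2b
    have h2 : Even b := even_iff_two_dvd.2 h2b
    have hna : ¬Even a := fun hea =>
      hsq2 b a hba 2 Nat.prime_two h2b (even_iff_two_dvd.1 hea)
    have hodd : ¬Odd (a * b * c) := by
      rw [Nat.not_odd_iff_even]; exact (h2.mul_left a).mul_right c
    unfold bvvSigmaTwo at hσ
    rw [if_neg hodd, if_neg hna, if_pos h2] at hσ
    by_cases hmod : (a : ℤ) ≡ (c : ℤ) [ZMOD 8]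
    · exact dvd_sub_comm.1 hmod.dvd
    · exact absurd (if_neg hmod) hσ
  · intro h2c
    have h2 : Even c := even_iff_two_dvd.2 h2c
    have hna : ¬Even a := fun hea =>
      hsq2 c a hca 2 Nat.prime_two h2c (even_iff_two_dvd.1 hea)
    have hnb : ¬Even b := fun heb =>
      hsq2 c b hcb 2 Nat.prime_two h2c (even_iff_two_dvd.1 heb)
    have hodd : ¬Odd (a * b * c) := by
      rw [Nat.not_odd_iff_even]; exact h2.mul_left (a * b)
    unfold bvvSigmaTwo at hσ
    rw [if_neg hodd, if_neg hna, if_neg hnb] at hσ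
    by_cases hmod : (a : ℤ) ≡ -(b : ℤ) [ZMOD 8]
    · have := hmod.dvd
      rw [show -(b : ℤ) - a = -((a : ℤ) + b) by ring, dvd_neg] at this
      exact this
    · exact absurd (if_neg hmod) hσ

/-- **Closed form of the summand under the solubility conditions**:
`bvvSummand (a,b,c) = (abc)^{-1/2} ∏_{p ∣ abc, p ≠ 2} 2/(p+1)` whenever it is non-zero.
[cite: BrowningValckenborgh2012, §2.4 (2.4)] -/
theorem bvvSummand_eq_closed {y : ℕ × ℕ × ℕ} (h : bvvSummand y ≠ 0) :
    bvvSummand y = ((y.1 * y.2.1 * y.2.2 : ℕ) : ℝ) ^ (-(1 / 2 : ℝ)) *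
      ∏ p ∈ (y.1 * y.2.1 * y.2.2).primeFactors.erase 2, (2 / ((p : ℝ) + 1)) := by
  obtain ⟨hsq, hσ, -, -, -, -, -, -⟩ := bvvSummand_ne_zero_conditions h
  obtain ⟨a, b, c⟩ := y
  simp only at h hsq hσ ⊢
  have habc : a * b * c ≠ 0 := hsq.ne_zero
  have ha : a ≠ 0 := by rintro rfl; simp at habc
  have hb : b ≠ 0 := by rintro rfl; simp at habc
  have hc : c ≠ 0 := by rintro rfl; simp at habc
  have hS : bvvSummand (a, b, c) = ((a * b * c : ℕ) : ℝ) ^ (-(3 / 2 : ℝ)) * (bvvSigmaTwo a b c : ℝ) *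
      (bvvOddFactor ((b : ℤ) * c) a * bvvOddFactor ((a : ℤ) * c) b * bvvOddFactor (-((a : ℤ) * b)) c) := by
    simp [bvvSummand, hsq]
  rw [hS] at h ⊢
  have hFa : bvvOddFactor ((b : ℤ) * c) a ≠ 0 := fun h0 => h (by rw [h0]; simp)
  have hFb : bvvOddFactor ((a : ℤ) * c) b ≠ 0 := fun h0 => h (by rw [h0]; simp)
  have hFc : bvvOddFactor (-((a : ℤ) * b)) c ≠ 0 := fun h0 => h (by rw [h0]; simp)
  have hsq2 : ∀ x z : ℕ, Squarefree (x * z) → ∀ p, p.Prime → p ∣ x → ¬p ∣ z := by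
    intro x z hxz p hp hx hz
    have : p * p ∣ x * z := mul_dvd_mul hx hz
    exact hp.ne_one (by simpa using hxz p this)
  have hab : Squarefree (a * b) := Squarefree.of_mul_left hsq
  have hac : Squarefree (a * c) := hsq.squarefree_of_dvd ⟨b, by ring⟩
  have hbc : Squarefree (b * c) := Squarefree.of_mul_right (by rwa [mul_assoc] at hsq)
  have hca : Squarefree (c * a) := by rwa [mul_comm] at hac
  have hcb : Squarefree (c * b) := by rwa [mul_comm] at hbc
  have hba : Squarefree (b * a) := by rwa [mul_comm] at hab
  have ndvd : ∀ {x z w : ℕ}, Squarefree (x * z) → Squarefree (x * w) →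
      ∀ p ∈ x.primeFactors, ¬(p : ℤ) ∣ (z : ℤ) * w := by
    intro x z w hxz hxw p hp hdvd
    have hpp := Nat.prime_of_mem_primeFactors hp
    have hpx := Nat.dvd_of_mem_primeFactors hp
    rcases (Nat.prime_iff_prime_int.1 hpp).dvd_or_dvd hdvd with h1 | h1
    · exact hsq2 x z hxz p hpp hpx (Int.natCast_dvd_natCast.1 h1)
    · exact hsq2 x w hxw p hpp hpx (Int.natCast_dvd_natCast.1 h1)
  obtain ⟨-, ea⟩ := bvvOddFactor_eq_of_ne_zero (ndvd hab hac) hFa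
  obtain ⟨-, eb⟩ := bvvOddFactor_eq_of_ne_zero (ndvd hba hbc) hFb
  obtain ⟨-, ec⟩ := bvvOddFactor_eq_of_ne_zero (fun p hp hd => ndvd hca hcb p hp (by
    rwa [dvd_neg] at hd)) hFc
  rw [ea, eb, ec]
  -- the odd prime factors of `abc` are the disjoint union of those of `a, b, c`
  have hunion : (a * b * c).primeFactors.erase 2 =
      (a.primeFactors.erase 2 ∪ b.primeFactors.erase 2) ∪ c.primeFactors.erase 2 := by
    rw [Nat.primeFactors_mul (mul_ne_zero ha hb) hc, Nat.primeFactors_mul ha hb,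
      Finset.erase_union_distrib, Finset.erase_union_distrib]
  have hdisj1 : Disjoint (a.primeFactors.erase 2) (b.primeFactors.erase 2) := by
    rw [Finset.disjoint_left]
    intro p hpa hpb
    exact hsq2 a b hab p (Nat.prime_of_mem_primeFactors (Finset.mem_erase.1 hpa).2)
      (Nat.dvd_of_mem_primeFactors (Finset.mem_erase.1 hpa).2)
      (Nat.dvd_of_mem_primeFactors (Finset.mem_erase.1 hpb).2)
  have hdisj2 : Disjoint (a.primeFactors.erase 2 ∪ b.primeFactors.erase 2) (c.primeFactors.erase 2) := by
    rw [Finset.disjoint_union_left, Finset.disjoint_left, Finset.disjoint_left]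
    exact ⟨fun p hpa hpc => hsq2 a c hac p (Nat.prime_of_mem_primeFactors (Finset.mem_erase.1 hpa).2)
        (Nat.dvd_of_mem_primeFactors (Finset.mem_erase.1 hpa).2)
        (Nat.dvd_of_mem_primeFactors (Finset.mem_erase.1 hpc).2),
      fun p hpb hpc => hsq2 b c hbc p (Nat.prime_of_mem_primeFactors (Finset.mem_erase.1 hpb).2)
        (Nat.dvd_of_mem_primeFactors (Finset.mem_erase.1 hpb).2)
        (Nat.dvd_of_mem_primeFactors (Finset.mem_erase.1 hpc).2)⟩
  -- `∏ 2p/(p+1) = (∏ p) · ∏ 2/(p+1)` and `σ₂ · ∏_{odd p ∣ abc} p = abc`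
  have hsplit : ∀ s : Finset ℕ, ∏ p ∈ s, (2 * (p : ℝ) / (p + 1)) =
      (∏ p ∈ s, (p : ℝ)) * ∏ p ∈ s, (2 / ((p : ℝ) + 1)) := by
    intro s; rw [← Finset.prod_mul_distrib]
    exact Finset.prod_congr rfl fun p _ => by ring
  rw [← Finset.prod_union hdisj1, ← Finset.prod_union hdisj2, ← hunion, hsplit]
  -- `σ₂ ∏_{odd p ∣ abc} p = abc`
  have hkey : (bvvSigmaTwo a b c : ℝ) * ∏ p ∈ (a * b * c).primeFactors.erase 2, (p : ℝ) =
      ((a * b * c : ℕ) : ℝ) := by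
    have hprod : ∏ p ∈ (a * b * c).primeFactors, (p : ℝ) = ((a * b * c : ℕ) : ℝ) := by
      rw [← Nat.cast_prod, Nat.prod_primeFactors_of_squarefree hsq]
    by_cases h2 : 2 ∈ (a * b * c).primeFactors
    · -- `2 ∣ abc`: `σ₂ = 2`
      have h2d : 2 ∣ a * b * c := Nat.dvd_of_mem_primeFactors h2
      have hodd : ¬Odd (a * b * c) := by
        rw [Nat.not_odd_iff_even]; exact even_iff_two_dvd.2 h2d
      have hσ2 : bvvSigmaTwo a b c = 2 := by
        unfold bvvSigmaTwo at hσ ⊢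
        rw [if_neg hodd] at hσ ⊢
        split_ifs at hσ ⊢ <;> first | rfl | exact absurd rfl hσ
      rw [hσ2, ← hprod, ← Finset.mul_prod_erase _ _ h2, Nat.cast_ofNat]
    · -- `abc` odd: `σ₂ = 1`
      have hodd : Odd (a * b * c) := by
        rw [← Nat.not_even_iff_odd, even_iff_two_dvd]
        intro h2d
        exact h2 (Nat.mem_primeFactors.2 ⟨Nat.prime_two, h2d, habc⟩)
      have hσ1 : bvvSigmaTwo a b c = 1 := by
        unfold bvvSigmaTwo at hσ ⊢
        rw [if_pos hodd] at hσ ⊢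
        split_ifs at hσ ⊢ <;> first | rfl | exact absurd rfl hσ
      rw [hσ1, Finset.erase_eq_of_notMem h2, hprod]; simp
  -- assemble: `d^{-3/2} σ₂ (∏ p) = d^{-1/2}`
  have hd0 : (0 : ℝ) < ((a * b * c : ℕ) : ℝ) := by exact_mod_cast Nat.pos_of_ne_zero habc
  have hpow : ((a * b * c : ℕ) : ℝ) ^ (-(3 / 2 : ℝ)) * ((a * b * c : ℕ) : ℝ) =
      ((a * b * c : ℕ) : ℝ) ^ (-(1 / 2 : ℝ)) := by
    rw [show (-(1 / 2 : ℝ)) = -(3 / 2 : ℝ) + 1 by norm_num, Real.rpow_add hd0, Real.rpow_one]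
  calc ((a * b * c : ℕ) : ℝ) ^ (-(3 / 2 : ℝ)) * (bvvSigmaTwo a b c : ℝ) *
        ((∏ p ∈ (a * b * c).primeFactors.erase 2, (p : ℝ)) *
          ∏ p ∈ (a * b * c).primeFactors.erase 2, (2 / ((p : ℝ) + 1)))
      = ((a * b * c : ℕ) : ℝ) ^ (-(3 / 2 : ℝ)) *
          ((bvvSigmaTwo a b c : ℝ) * ∏ p ∈ (a * b * c).primeFactors.erase 2, (p : ℝ)) *
          ∏ p ∈ (a * b * c).primeFactors.erase 2, (2 / ((p : ℝ) + 1)) := by ring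
    _ = _ := by rw [hkey, hpow]

end Literature.NumberTheory.DiophantineGeometry
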